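import Summits.HodgeConjecture.HodgeConjecture.Theorems.GenericDivisibilityGenericDivisibilityBoundedHeartFunctionField
import HarnessLib

/-!
# Route GenericDivisibility — crux C2 `GenericDivisibilityBounded` (stmt-HodgeConjecture-18467),
# line `finite-level-bootstrap`: a clean level is a bounded exponent at the generic point

Sorry-free, definition-free record of the registered sub-goal
`stub_levelCleanIffBoundedGenericTorsion` (lead c5) of the line `finite-level-bootstrap` on the crux C2
of route `GenericDivisibility`, sequel of `…HeartFunctionField` (p163474, the heart of the line written
entirely at the generic point).

For `X` irreducible over `ℂ`, a degree `k`, `ρ := Motives.toFunctionField ℤ X k :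
H^k(X(ℂ); ℤ) → H^k(ℂ(X); ℤ)` (restriction to the generic point, Bloch–Ogus 1974, (3.8)–(3.9);
Colliot-Thélène–Voisin 2012, §2.1) and `ℓ ≥ 1`, `a : ℕ`:

* "level `ℓ^(a+1)` is CLEAN in degree `k`" — every integral class `z` divisible by `ℓ^(a+1)` up to
  torsion on a non-empty Zariski open admits `w` with `z - ℓ • w` generically torsion — holds iff
* "the `ℓ`-exponent of `H^k(ℂ(X); ℤ)` modulo `im ρ` and modulo torsion is at most `a`" — every
  `f ∈ H^k(ℂ(X); ℤ)` with `M • (ρ z - ℓ^r • f) = 0` for some `z`, `r`, `M ≥ 1` admits `w` and `N ≥ 1` with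
  `N • (ρ w - ℓ^a • f) = 0`.

After `stub_levelCleanIffFunctionField` (at `s := a + 1`) both sides live in the abelian group
`H^k(ℂ(X); ℤ)` and the statement is elementary algebra about an additive map `ρ : A → B` of abelian
groups, proved first in that generality:

* `levelClean_of_boundedExponent` (`←`): from `M • (ρ z - ℓ^(a+1) • f) = 0` and the bound applied to
  `(f, r := a + 1)` one gets `w`, `N` with `N • (ρ w - ℓ^a • f) = 0`, and then
  `(M N) • ρ (z - ℓ • w) = N • M • (ρ z - ℓ^(a+1) • f) - (M ℓ) • N • (ρ w - ℓ^a • f) = 0`.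
* `boundedExponent_of_levelClean` (`→`), by strong induction on `r`: if `r ≤ a`, `a = r + d`, take
  `w := ℓ^d • z` (same multiplier `M`); if `r = a + e + 1`, the clean level applied to `z` and
  `ℓ^e • f` gives `w₁`, `N₁ ≥ 1` with `N₁ • (ρ z - ℓ • ρ w₁) = 0`, whence
  `(M N₁ ℓ) • (ρ w₁ - ℓ^(a+e) • f) = 0` — the hypothesis at the smaller exponent `a + e` (here `ℓ ≥ 1`
  keeps the multiplier `≥ 1`), and the induction hypothesis concludes.

References: [BlochOgus1974ENS] (3.8)–(3.9); [ColliotTheleneVoisin2012] §2.1, Thm. 2.8 (ii).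
-/

set_option linter.dupNamespace false

noncomputable section

namespace Summit.HodgeConjecture.HodgeConjecture.Theorems

open CategoryTheory AlgebraicGeometry
open Literature.AlgebraicGeometry.Motives Literature.AlgebraicGeometry.HodgeTheory
  Literature.AlgebraicTopology.SingularHomology

/-! ### The algebra: clean level `a + 1` versus exponent bound `a`, for an additive map -/

section Algebra

variable {A B F : Type*} [AddCommGroup A] [AddCommGroup B] [FunLike F A B] [AddMonoidHomClass F A B]

/-- **Exponent bound `a` implies level `ℓ^(a+1)` clean**, for an additive map `ρ : A → B` of abelian
groups and `ℓ a : ℕ`: if every `f : B` with `M • (ρ z - ℓ^r • f) = 0` for some `z`, `r`, `M ≥ 1` admits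
`w`, `N ≥ 1` with `N • (ρ w - ℓ^a • f) = 0`, then every `z` with `M • (ρ z - ℓ^(a+1) • f) = 0` for some
`f`, `M ≥ 1` admits `w`, `N ≥ 1` with `ρ (N • (z - ℓ • w)) = 0`: apply the bound to `(f, a + 1)` and use
`(M N) • (ρ z - ℓ • ρ w) = N • M • (ρ z - ℓ^(a+1) • f) - (M ℓ) • N • (ρ w - ℓ^a • f)`. [folklore] -/
theorem levelClean_of_boundedExponent (ρ : F) (ℓ a : ℕ)
    (h : ∀ (f : B) (r : ℕ), (∃ (z : A) (M : ℕ), 1 ≤ M ∧ M • (ρ z - ℓ ^ r • f) = 0) →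
      ∃ (w : A) (N : ℕ), 1 ≤ N ∧ N • (ρ w - ℓ ^ a • f) = 0)
    (z : A) (hz : ∃ (f : B) (M : ℕ), 1 ≤ M ∧ M • (ρ z - ℓ ^ (a + 1) • f) = 0) :
    ∃ (w : A) (N : ℕ), 1 ≤ N ∧ ρ (N • (z - ℓ • w)) = 0 := by
  obtain ⟨f, M, hM, hf⟩ := hz
  obtain ⟨w, N, hN, hw⟩ := h f (a + 1) ⟨z, M, hM, hf⟩
  refine ⟨w, M * N, one_le_mul_of_one_le_of_one_le hM hN, ?_⟩
  rw [map_nsmul, map_sub, map_nsmul]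
  linear_combination (norm := module) N • hf - (M * ℓ) • hw

/-- **Level `ℓ^(a+1)` clean implies the exponent bound `a`**, for an additive map `ρ : A → B` of
abelian groups, `ℓ ≥ 1` and `a : ℕ`: if every `z` with `M • (ρ z - ℓ^(a+1) • f) = 0` for some `f`,
`M ≥ 1` admits `w`, `N ≥ 1` with `ρ (N • (z - ℓ • w)) = 0`, then every `f : B` with
`M • (ρ z - ℓ^r • f) = 0` for some `z`, `r`, `M ≥ 1` admits `w`, `N ≥ 1` with `N • (ρ w - ℓ^a • f) = 0`.
Strong induction on `r`: for `r ≤ a`, `a = r + d`, take `w := ℓ^d • z`; for `r = a + e + 1` the clean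
level at `(z, ℓ^e • f)` gives `w₁`, `N₁` with `N₁ • (ρ z - ℓ • ρ w₁) = 0`, so
`(M N₁ ℓ) • (ρ w₁ - ℓ^(a+e) • f) = 0`, the hypothesis at the smaller exponent `a + e`. [folklore] -/
theorem boundedExponent_of_levelClean (ρ : F) {ℓ : ℕ} (a : ℕ) (hℓ : 1 ≤ ℓ)
    (h : ∀ z : A, (∃ (f : B) (M : ℕ), 1 ≤ M ∧ M • (ρ z - ℓ ^ (a + 1) • f) = 0) →
      ∃ (w : A) (N : ℕ), 1 ≤ N ∧ ρ (N • (z - ℓ • w)) = 0)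
    (f : B) (r : ℕ) (hf : ∃ (z : A) (M : ℕ), 1 ≤ M ∧ M • (ρ z - ℓ ^ r • f) = 0) :
    ∃ (w : A) (N : ℕ), 1 ≤ N ∧ N • (ρ w - ℓ ^ a • f) = 0 := by
  induction r using Nat.strong_induction_on generalizing f with
  | h r ih =>
    obtain ⟨z, M, hM, hz⟩ := hf
    obtain hr | hr := le_or_gt r a
    · -- `r ≤ a`: multiply `z` by the missing power of `ℓ`
      obtain ⟨d, rfl⟩ := Nat.exists_eq_add_of_le hr
      refine ⟨ℓ ^ d • z, M, hM, ?_⟩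
      rw [map_nsmul]
      linear_combination (norm := module) ℓ ^ d • hz
    · -- `r = a + e + 1`: one step of the clean level, then the induction hypothesis at `a + e`
      obtain ⟨e, rfl⟩ := Nat.exists_eq_add_of_lt hr
      obtain ⟨w₁, N₁, hN₁, hw₁⟩ :=
        h z ⟨ℓ ^ e • f, M, hM, by linear_combination (norm := module) hz⟩
      rw [map_nsmul, map_sub, map_nsmul] at hw₁
      exact ih (a + e) (Nat.lt_succ_self _) f
        ⟨w₁, M * N₁ * ℓ, one_le_mul_of_one_le_of_one_le (one_le_mul_of_one_le_of_one_le hM hN₁) hℓ,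
          by linear_combination (norm := module) N₁ • hz - M • hw₁⟩

/-- **Clean level `ℓ^(a+1)` ⟺ exponent bound `a`**, for an additive map `ρ : A → B` of abelian groups,
`ℓ ≥ 1` and `a : ℕ` (conjunction of `boundedExponent_of_levelClean` and
`levelClean_of_boundedExponent`). [folklore] -/
theorem levelClean_iff_boundedExponent (ρ : F) {ℓ : ℕ} (a : ℕ) (hℓ : 1 ≤ ℓ) :
    (∀ z : A, (∃ (f : B) (M : ℕ), 1 ≤ M ∧ M • (ρ z - ℓ ^ (a + 1) • f) = 0) →
        ∃ (w : A) (N : ℕ), 1 ≤ N ∧ ρ (N • (z - ℓ • w)) = 0) ↔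
      ∀ (f : B) (r : ℕ), (∃ (z : A) (M : ℕ), 1 ≤ M ∧ M • (ρ z - ℓ ^ r • f) = 0) →
        ∃ (w : A) (N : ℕ), 1 ≤ N ∧ N • (ρ w - ℓ ^ a • f) = 0 :=
  ⟨boundedExponent_of_levelClean ρ a hℓ, levelClean_of_boundedExponent ρ ℓ a⟩

end Algebra

/-! ### The registered sub-goal -/

/-- **Registered sub-goal `stub_levelCleanIffBoundedGenericTorsion` of stmt-HodgeConjecture-18467
(line `finite-level-bootstrap`, lead c5): a clean level is a bounded exponent at the generic point.**
For `X` irreducible over `ℂ`, any degree `k`, `1 ≤ ℓ` and any `a`, with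
`ρ = toFunctionField ℤ X k : H^k(X(ℂ); ℤ) → H^k(ℂ(X); ℤ)` (Bloch–Ogus 1974, (3.8)–(3.9): restriction to
the generic point, `H^k(ℂ(X); ℤ) = colim_{U ∋ η} H^k(U(ℂ); ℤ)`; Colliot-Thélène–Voisin 2012, §2.1): level
`ℓ^(a+1)` is clean in degree `k` ("every `z` divisible by `ℓ^(a+1)` up to torsion on a non-empty Zariski
open admits `w` with `z - ℓ • w` generically torsion") iff every generic class `f` some `ℓ`-power
multiple of which lies in `im ρ` up to torsion (`M • (ρ z - ℓ^r • f) = 0`, `M ≥ 1`) has `ℓ^a • f ∈ im ρ`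
up to torsion (`N • (ρ w - ℓ^a • f) = 0`, `N ≥ 1`). Proof: `stub_levelCleanIffFunctionField` at
`s := a + 1` moves the left side to the generic point, and `levelClean_iff_boundedExponent` is the
remaining algebra. [cite: BlochOgus1974ENS, (3.8)–(3.9)]
[cite: ColliotTheleneVoisin2012, §2.1 and Thm. 2.8 (ii)] -/
theorem stub_levelCleanIffBoundedGenericTorsion :
    ∀ ⦃X : SchemeOver ℂ⦄ [IrreducibleSpace X.left] (k ℓ a : ℕ), 1 ≤ ℓ →
      ((∀ z : singularCohomology ℤ ℤ (ComplexPoints X) k,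
          (∃ Z : Set X.left, IsClosed Z ∧ Z ≠ Set.univ ∧
            ∃ (y : singularCohomology ℤ ℤ (complexPointsCompl X Z) k) (M : ℕ), 1 ≤ M ∧
              M • (singularCohomology.map ℤ ℤ
                (⟨Subtype.val, continuous_subtype_val⟩ : C(complexPointsCompl X Z, ComplexPoints X))
                k z - ℓ ^ (a + 1) • y) = 0) →
          ∃ w : singularCohomology ℤ ℤ (ComplexPoints X) k,
            ∃ Z : Set X.left, IsClosed Z ∧ Z ≠ Set.univ ∧ ∃ N : ℕ, 1 ≤ N ∧
              N • singularCohomology.map ℤ ℤ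
                (⟨Subtype.val, continuous_subtype_val⟩ : C(complexPointsCompl X Z, ComplexPoints X))
                k (z - ℓ • w) = 0) ↔
        (∀ (f : functionFieldCohomology ℤ X k) (r : ℕ),
          (∃ (z : singularCohomology ℤ ℤ (ComplexPoints X) k) (M : ℕ), 1 ≤ M ∧
              M • (toFunctionField ℤ X k z - ℓ ^ r • f) = 0) →
          ∃ (w : singularCohomology ℤ ℤ (ComplexPoints X) k) (N : ℕ), 1 ≤ N ∧
              N • (toFunctionField ℤ X k w - ℓ ^ a • f) = 0)) := by
  intro X _ k ℓ a hℓ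
  rw [stub_levelCleanIffFunctionField k ℓ (a + 1)]
  exact levelClean_iff_boundedExponent _ a hℓ

end Summit.HodgeConjecture.HodgeConjecture.Theorems

end
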